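import Summits.QuantumFields.YangMills.Theorems.UnitScaleTiltProp8FlatCubeQContraction
import Summits.QuantumFields.YangMills.Theorems.UnitScaleTiltProp8FlatOpsHRowsFromKernels
import HarnessLib

/-!
# Route `UnitScaleTilt`, crux K1 child «MinimiserStabilityRegPr» (stmt-QuantumFields-19200), v8 pillar **P2 `stub_flatOpsCubeSeq`** — OWNER RULING g21-№4 §B3(a),
# file 4 of the P2 assembly: **ONE STOP — THE REGISTERED TEXT `FlatCubeOpsText.FlatOpsAdmAtMS` FROM THE PORT-SHAPED ROWS ALONE**
# (the Q-row discharged by `FlatCubeQContraction.qContrLetter_of_adm22`, the H-letters by `FlatOpsHRowsFromKernels.hRows_of_kernelRows`, the assembly by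
# `FlatOpsLettersAssembly.flatOpsAdmAtMS_of_rows`)

Cell `ym3-torus` (HUMAN RULING D-0037, YM ladder rung R3), seat `ym3-torus-p1` gen 16.  `--supports stmt-QuantumFields-19200 --as helper`; count-neutral.

WHAT IS PROVED (sorry-free; axioms standard).
* **`KernelRowsAt F n K D w C δ₀ B₃ C_G`** — THE PORT-SHAPED INPUT OF P2 AT ONE DATUM: a distance `dBI ≥ distBI` on (fine bond) × (index bond) carrying the (162) row
  sum `RowSum162 … δ₀ B₃` and the four kernel rows `HKernelRows … (flatH …) C δ₀` of the canonical `H = GQ*(QGQ*)⁻¹` ([Balaban1984PropagatorsII] Cor. 2.8 (2.151)₁,₂ = the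
  port's `B6Cor28EntriesKLevelV1.cor28_kLevel_H_DH` row shape; [Balaban1985Variational] (139)–(140)/(130) kernel rows), AND the three operator rows
  ([Balaban1984PropagatorsII] Prop. 2.6 (2.136)₁,₂,₄ = `GtSupLetterG`/`GtLaplaceLetterG` shapes, constant `C_G`) of the genuine `G = Δ_a⁻¹ = GE D` for SOME positive weights;
* **`rowsAt_of_kernelRowsAt`**: under the text's binders (`D.k = K − n`, `Adm22 D R M`) and `R·M ≥ 2L`: `KernelRowsAt … C δ₀ B₃ C_G ⇒ RowsAt … (max C (C·B₃)) δ₀ B₃ C_G L`;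
* **`flatOpsAdmAtMS_of_kernelRows`**: if `2L ≤ R₀·M₀` and every admissible datum of the text carries `KernelRowsAt … C δ₀ B₃ C_G` (`C, δ₀, C_G ≥ 0`), then
  `FlatOpsAdmAtMS L R₀ M₀ B₀′ δ₀ B₃` with the explicit `B₀′ = max B₁ (C_G + B₁·L·C_G)`, `B₁ = max C (C·B₃)`.
So the registered stub `stub_flatOpsCubeSeq : ∀ L > 1, ∃ R₀ M₀ B₀ δ₀ B₃, … ∧ FlatOpsAdmAtMS L R₀ M₀ B₀ δ₀ B₃` is EXACTLY: for every odd `L > 1`, constants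
`(R₀, M₀, C, δ₀ > 0, B₃ > 0, C_G)` with `2L ≤ R₀M₀` and `KernelRowsAt` at every admissible datum — [Balaban1984PropagatorsII] §2 (Prop. 2.6, Cor. 2.8, Lemma 2.1/(2.46)
for the distance and (162)) for nested families WITH a level-0 region at the d = 3 carrier (gap G-F3′-L0, lit-balaban `B6MultiLevel*L0` lineage) + the two second-order
kernel rows of `H` ([Balaban1985Variational] (130), (139)–(140); C-B11-F1).  HONEST SCOPE: packaging; no estimate proved; NOT a claim about the mass gap.

References: T. Bałaban, CMP **96** (1984) 223–250 [Balaban1984PropagatorsII] (2.2) p.224, (2.46) p.231, Prop. 2.6 (2.136) p.247, Cor. 2.8 (2.150)–(2.151) p.249;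
CMP **102** (1985) 277–309 [Balaban1985Variational] (46) p.285, (130) p.298, (157)–(158) p.302, (161)–(163) p.303, (165) p.304.
-/

set_option autoImplicit false

noncomputable section

namespace Summit.QuantumFields.YangMills.Theorems.FlatOpsFromKernelRows

open Literature.MathematicalPhysics.QuantumFieldTheory.Balaban1983to89
open B6SectADomainsV1 (Domains)
open B6SectAOperatorsV1 (BondIdx)
open T3ContinuumYM3Torus (T3Family)
open FlatCubeOpsText (Adm22 distBI IsLevWeight GtSupLetterG GtLaplaceLetterG RowSum162 FlatOpsAdmAtMS)
open FlatOpsLettersAssembly (flatH IsFlatGW RowsAt flatOpsAdmAtMS_of_rows)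
open FlatOpsHRowsFromKernels (HKernelRows hRows_of_kernelRows)
open FlatCubeQContraction (qContrLetter_of_adm22)

section Datum

variable (F : T3Family) (n K : ℕ) (D : Domains (F.P K))

/-- **THE PORT-SHAPED INPUT OF P2 AT ONE DATUM**: (H) a distance `dBI ≥ distBI` with the (162) row sum and the four kernel rows of the canonical `H` at rate `δ₀`
((2.151)₁,₂, (139)–(140), (130)); (G) the genuine `G = Δ_a⁻¹` with some positive weights and its (2.136)₁,₂,₄ operator rows, constant `C_G`.
[cite: Balaban1984PropagatorsII, Prop. 2.6 (2.136) p.247, Cor. 2.8 (2.150)-(2.151) p.249, (2.46) p.231; Balaban1985Variational, (130) p.298, (139)-(140) p.299, (162) p.303] -/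
def KernelRowsAt (w : ℕ → PBond (F.P K) 0 → ℝ) (C δ₀ B₃ CG : ℝ) : Prop :=
  (∃ dBI : PBond (F.P K) 0 → BondIdx D → ℝ,
      (∀ b c, distBI D b c ≤ dBI b c) ∧ RowSum162 F n K D dBI w δ₀ B₃ ∧ HKernelRows F n K D dBI w (flatH F n K D) C δ₀) ∧
  ∃ (w' : BondIdx D → ℝ) (hw' : ∀ i, 0 < w' i) (G : (PBond (F.P K) 0 → ℝ) →ₗ[ℝ] (PBond (F.P K) 0 → ℝ)),
    IsFlatGW F n K D hw' G ∧ GtSupLetterG F n K w G CG ∧ GtLaplaceLetterG F n K w G CG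

variable {F n K D}

/-- **`KernelRowsAt ⇒ RowsAt`** under the text's binders and `R·M ≥ 2L` (the Q-row with `C_Q = L`, the `H`-letters at `max C (C·B₃)`).
[cite: Balaban1984PropagatorsII, (2.2) p.224, Prop. 2.6 (2.136) p.247, Cor. 2.8 (2.150)-(2.151) p.249; Balaban1985Variational, (46) p.285, (130) p.298, (161)-(162) p.303] -/
theorem rowsAt_of_kernelRowsAt {w : ℕ → PBond (F.P K) 0 → ℝ} (hw : IsLevWeight F n K D w) (hDk : D.k = K - n) {R M : ℕ} (hAdm : Adm22 D R M)
    (hRM : 2 * F.L ≤ R * M) {C δ₀ B₃ CG : ℝ} (hC : 0 ≤ C) (hδ₀ : 0 ≤ δ₀) (h : KernelRowsAt F n K D w C δ₀ B₃ CG) :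
    RowsAt F n K D w (max C (C * B₃)) δ₀ B₃ CG (F.L : ℝ) := by
  obtain ⟨⟨dBI, hcomp, hrow, hk⟩, hG⟩ := h
  obtain ⟨h1, h2, h3, h4, h5⟩ := hRows_of_kernelRows hw hDk hC (by linarith) hcomp hk hrow
  exact ⟨⟨h1, h2, dBI, h3, h4, h5⟩, hG, qContrLetter_of_adm22 F n K D hDk hAdm hRM w hw⟩

end Datum

/-- **P2 FROM THE PORT-SHAPED ROWS — ONE STOP**: `2L ≤ R₀M₀`, `C, δ₀, C_G ≥ 0`, and `KernelRowsAt F n K D w C δ₀ B₃ C_G` at every admissible datum of the text give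
`FlatOpsAdmAtMS L R₀ M₀ (max B₁ (C_G + B₁·L·C_G)) δ₀ B₃`, `B₁ = max C (C·B₃)`.  The registered `stub_flatOpsCubeSeq` then follows by choosing the constants (`δ₀, B₃ > 0`,
`B₀′ > 0` — e.g. `C > 0`). [cite: Balaban1985Variational, (46) p.285, (130) p.298, (157)-(158) p.302, (161)-(163) p.303, (165) p.304; Balaban1984PropagatorsII, Prop. 2.6 (2.136) p.247, Cor. 2.8 (2.150)-(2.151) p.249] -/
theorem flatOpsAdmAtMS_of_kernelRows {L R₀ M₀ : ℕ} (hRM : 2 * L ≤ R₀ * M₀) {C δ₀ B₃ CG : ℝ} (hC : 0 ≤ C) (hδ₀ : 0 ≤ δ₀) (hCG : 0 ≤ CG)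
    (h : ∀ (F : T3Family), F.L = L → ∀ (n K : ℕ), n < K → ∀ (R M : ℕ), R₀ ≤ R → M₀ ≤ M → (∃ a : ℕ, M = L ^ a) →
      ∀ (D : Domains (F.P K)), D.k = K - n → Adm22 D R M →
      ∀ (w : ℕ → PBond (F.P K) 0 → ℝ), IsLevWeight F n K D w → KernelRowsAt F n K D w C δ₀ B₃ CG) :
    FlatOpsAdmAtMS L R₀ M₀ (max (max C (C * B₃)) (CG + max C (C * B₃) * (L : ℝ) * CG)) δ₀ B₃ := by
  refine flatOpsAdmAtMS_of_rows hCG (Nat.cast_nonneg L) fun F hF n K hnK R M hR hM hMa D hDk hAdm w hw => ?_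
  have hRM' : 2 * F.L ≤ R * M := by
    rw [hF]
    exact hRM.trans (Nat.mul_le_mul hR hM)
  have h1 := rowsAt_of_kernelRowsAt hw hDk hAdm hRM' hC hδ₀ (h F hF n K hnK R M hR hM hMa D hDk hAdm w hw)
  rw [hF] at h1
  exact h1

end Summit.QuantumFields.YangMills.Theorems.FlatOpsFromKernelRows

end
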